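import Summits.HodgeConjecture.HodgeConjecture.Theorems.Ring2WeilCoverageCMFieldNormResidueSymbolsDyadic
import Summits.HodgeConjecture.HodgeConjecture.Theorems.Ring2WeilCoverageCMFieldNormResidueSymbolsDyadicResidueFields
import HarnessLib

/-!
# Ring 2 — Weil-family coverage, CM-field rows: THE DYADIC COLUMN of the `T`-labels for the four census carriers
  RAMIFIED above `2` in `E/F` — `ℚ(ζ₈)`, `ℚ(i,√5)`, `ℚ(√-(2+√2))`, `ℚ(√-(3+√2))` — by the parity complement
  (WEIL-FAMILY-COVERAGE «## b03», sub-cell (ix″), part 9)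

research route conditional on HC_CM; not a corollary; Q11.4-sentence-2 already refuted in dim ≥ 3.

On Deligne's carriers `F = ℚ[S]/(R) = ℚ(θ) ⊂ E = F(√θ)` the rows `W_{2k}.E.δ` are labelled by `T(q) = badPlaces q θ`
[cite: Deligne1982HodgeCycles, §4: display (1), Prop. 4.1, Cor. 4.2].  For the four quartic census fields of §b03.5 whose
quadratic extension `E/F` is RAMIFIED at the dyadic place `v₂` of `F` (no dyadic normalisation `θ = c²(1+4ρ)` exists; the
dyadic unit residues would need O'Meara §63A's higher congruences) the dyadic entry of `T(q)` is nevertheless DECIDED: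
`|T(q)|` is even (Hilbert reciprocity 71:18 [cite: Omeara1963, §71D Thm. 71:18]) and `v₂` is the ONLY dyadic place of
`F = ℚ(√2)` resp. `ℚ(√5)`, so **`v₂ ∈ T(q) ⟺` the number of non-dyadic places of `T(q)` is odd**
(`Ring2WeilCoverageCMFieldNormResidueSymbolsDyadic.inl_mem_badPlaces_iff_odd_ncard_of_unique_dyadic`), all of which are in
closed form by parts 2 (infinite places: signs), 3 (inert/split `v ∤ 2θ`: valuation parity) and 5 (ramified non-dyadic:
unit residues).  The uniqueness of `v₂` is proved in each carrier's own terms with the toolkit of part 7: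

* §18 `F = ℚ(√2)`: `ℚ(√-(2+√2))` (`R = S² + 4S + 2`, `(θ+2)² = 2`), `ℚ(√-(3+√2))` (`R = S² + 6S + 7`, `(θ+3)² = 2`),
  `ℚ(ζ₈)` (`R = S² + 6S + 1`, `((θ+3)/2)² = 2`): `v₂ = (√2)` unique, residue field `𝔽₂`, `ord_{v₂} 2 = 2`;
  `F = ℚ(√5)`: `ℚ(i,√5)` (`R = S² + 3S + 1`, `θ² - θ = -4θ - 1 ∉ v₂`): `v₂ = (2)` unique, `ord_{v₂} 2 = 1`;
  and the four parity statements `…_inl_mem_badPlaces_dyadic_iff`.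
With parts 6–8 the dyadic column of the `T`-labels is decided for ALL SEVEN quartic census carriers.  No new definition,
no named fact, no sorry; nothing about the Hodge conjecture is asserted.
-/

noncomputable section

set_option linter.dupNamespace false

open Polynomial NumberField IsDedekindDomain

namespace Summit.HodgeConjecture.HodgeConjecture.Ring2.WeilCoverageCM

open Literature.AlgebraicGeometry.Deligne1982
open Literature.NumberTheory.QuadraticForms

/-! ### §18 The four census carriers RAMIFIED at the dyadic place of `E/F`: the dyadic place of `F` is unique, and its
membership in `T(q)` is the parity of the other memberships (Hilbert reciprocity) -/

section SqrtTwoFields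

variable {R : Polynomial ℤ} [Fact (Irreducible (cmPolyQ R))] [Fact (Irreducible (realPolyQ R))]

omit [Fact (Irreducible (cmPolyQ R))] in
/-- `ℚ(√-(2+√2))` (`R = S² + 4S + 2`, `θ = -2 ± √2`): `(θ + 2)² = 2` in `𝓞_F`, so `2` ramifies in `F = ℚ(√2)` with the
uniformiser `π = θ + 2`. [folklore] -/
theorem sqrtNegTwoPlusSqrtTwo_sq_eq_two (hR : R = X ^ 2 + C 4 * X + C 2) {θₒ : 𝓞 (realField R)}
    (hθ : (θₒ : realField R) = AdjoinRoot.root (realPolyQ R)) : (θₒ + 2) ^ 2 = 2 := by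
  have hrel : θₒ ^ 2 + 4 * θₒ + 2 = 0 := by simpa using ringOfIntegers_root_rel_quadratic hR hθ
  linear_combination hrel

omit [Fact (Irreducible (cmPolyQ R))] in
/-- `ℚ(√-(3+√2))` (`R = S² + 6S + 7`, `θ = -3 ± √2`): `(θ + 3)² = 2` in `𝓞_F`. [folklore] -/
theorem dFour_sq_eq_two (hR : R = X ^ 2 + C 6 * X + C 7) {θₒ : 𝓞 (realField R)}
    (hθ : (θₒ : realField R) = AdjoinRoot.root (realPolyQ R)) : (θₒ + 3) ^ 2 = 2 := by
  have hrel : θₒ ^ 2 + 6 * θₒ + 7 = 0 := by simpa using ringOfIntegers_root_rel_quadratic hR hθ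
  linear_combination hrel

omit [Fact (Irreducible (cmPolyQ R))] in
/-- `ℚ(ζ₈)` (`R = S² + 6S + 1`, `θ = -3 ± 2√2`): `√2 = (θ + 3)/2 ∈ 𝓞_F` with square `2`. [folklore] -/
theorem zeta8_exists_sq_eq_two (hR : R = X ^ 2 + C 6 * X + C 1) :
    ∃ s : 𝓞 (realField R), (s : realField R) = (AdjoinRoot.root (realPolyQ R) + 3) / 2 ∧ s ^ 2 = 2 := by
  have hrel := root_rel_quadratic hR
  push_cast at hrel
  have hsq : ((AdjoinRoot.root (realPolyQ R) + 3) / 2) ^ 2 = (2 : realField R) := by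
    field_simp
    linear_combination hrel
  have hint : IsIntegral ℤ ((AdjoinRoot.root (realPolyQ R) + 3) / 2) := by
    refine ⟨X ^ 2 - C 2, by monicity!, ?_⟩
    simp [hsq]
  refine ⟨⟨_, hint⟩, rfl, ?_⟩
  refine RingOfIntegers.ext ?_
  simp only [map_pow, map_ofNat]
  exact hsq

omit [Fact (Irreducible (cmPolyQ R))] in
/-- **`F = ℚ(√2)` (carriers `ℚ(√-(2+√2))`, `ℚ(√-(3+√2))`, `ℚ(ζ₈)`): the dyadic place is UNIQUE, `= (√2)`, with residue
field `𝔽₂` and `ord 2 = 2`** — given any `π ∈ 𝓞_F` with `π² = 2`. [folklore] -/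
theorem sqrtTwo_dyadic (hF : Module.finrank ℚ (realField R) = 2) {π : 𝓞 (realField R)} (hπ2 : π ^ 2 = 2)
    (v : HeightOneSpectrum (𝓞 (realField R))) (h2 : (2 : 𝓞 (realField R)) ∈ v.asIdeal) :
    v.asIdeal = Ideal.span {π} ∧ (∀ x : 𝓞 (realField R), x ^ 2 - x ∈ v.asIdeal) ∧
      WithZero.log (v.valuation (realField R) (2 : realField R)) = -2 ∧
      ∀ v' : HeightOneSpectrum (𝓞 (realField R)), (2 : 𝓞 (realField R)) ∈ v'.asIdeal → v' = v := by
  have hπ : π ^ 2 = 2 * 1 := by rw [mul_one]; exact hπ2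
  refine ⟨asIdeal_eq_span_of_dyadic_of_sq_eq_two_mul_unit hF isUnit_one hπ v h2,
    sq_sub_self_mem_of_dyadic_of_sq_eq_two_mul_unit hF isUnit_one hπ v h2, ?_,
    fun v' h2' ↦ dyadic_unique_of_sq_eq_two_mul_unit hF isUnit_one hπ v' v h2' h2⟩
  rw [show (2 : realField R) = algebraMap (𝓞 (realField R)) (realField R) 2 by rw [map_ofNat],
    HeightOneSpectrum.valuation_of_algebraMap,
    intValuation_two_of_dyadic_of_sq_eq_two_mul_unit hF isUnit_one hπ v h2, WithZero.log_exp]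

/-- **THE DYADIC COLUMN for `ℚ(√-(2+√2))`** (`E/F` ramified at `v₂ = (√2)`, `θ` a dyadic uniformiser — no dyadic
normalisation): `v₂ ∈ T(q) ⟺` the number of NON-dyadic places (finite `v ≠ v₂`, decided by parts 3/5, and infinite,
decided by signs) in `T(q)` is ODD. [cite: Omeara1963, §71D Thm. 71:18] [cite: Deligne1982HodgeCycles, §4 (1)] -/
theorem sqrtNegTwoPlusSqrtTwo_inl_mem_badPlaces_dyadic_iff (hR : R = X ^ 2 + C 4 * X + C 2) {θₒ : 𝓞 (realField R)}
    (hθ : (θₒ : realField R) = AdjoinRoot.root (realPolyQ R)) (v : HeightOneSpectrum (𝓞 (realField R)))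
    (h2 : (2 : 𝓞 (realField R)) ∈ v.asIdeal) (q : (realField R)ˣ) :
    Sum.inl v ∈ badPlaces (q : realField R) (AdjoinRoot.root (realPolyQ R)) ↔
      Odd {p ∈ badPlaces (q : realField R) (AdjoinRoot.root (realPolyQ R)) |
        ∀ v' : HeightOneSpectrum (𝓞 (realField R)), p = Sum.inl v' → (2 : 𝓞 (realField R)) ∉ v'.asIdeal}.ncard :=
  inl_mem_badPlaces_iff_odd_ncard_of_unique_dyadic q v h2
    (sqrtTwo_dyadic (finrank_realField_quadratic hR) (sqrtNegTwoPlusSqrtTwo_sq_eq_two hR hθ) v h2).2.2.2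

/-- **THE DYADIC COLUMN for `ℚ(√-(3+√2))`** (the `D₄` field; `E/F` ramified at `v₂ = (√2)`, `θ ≡ 1 + √2·unit`):
`v₂ ∈ T(q) ⟺` the number of non-dyadic places in `T(q)` is odd. [cite: Omeara1963, §71D Thm. 71:18]
[cite: Deligne1982HodgeCycles, §4 (1)] -/
theorem dFour_inl_mem_badPlaces_dyadic_iff (hR : R = X ^ 2 + C 6 * X + C 7) {θₒ : 𝓞 (realField R)}
    (hθ : (θₒ : realField R) = AdjoinRoot.root (realPolyQ R)) (v : HeightOneSpectrum (𝓞 (realField R)))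
    (h2 : (2 : 𝓞 (realField R)) ∈ v.asIdeal) (q : (realField R)ˣ) :
    Sum.inl v ∈ badPlaces (q : realField R) (AdjoinRoot.root (realPolyQ R)) ↔
      Odd {p ∈ badPlaces (q : realField R) (AdjoinRoot.root (realPolyQ R)) |
        ∀ v' : HeightOneSpectrum (𝓞 (realField R)), p = Sum.inl v' → (2 : 𝓞 (realField R)) ∉ v'.asIdeal}.ncard :=
  inl_mem_badPlaces_iff_odd_ncard_of_unique_dyadic q v h2
    (sqrtTwo_dyadic (finrank_realField_quadratic hR) (dFour_sq_eq_two hR hθ) v h2).2.2.2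

/-- **THE DYADIC COLUMN for `ℚ(ζ₈)`** (`E = F(√-1)` ramified at `v₂ = (√2)`): `v₂ ∈ T(q) ⟺` the number of
non-dyadic places in `T(q)` is odd. [cite: Omeara1963, §71D Thm. 71:18] [cite: Deligne1982HodgeCycles, §4 (1)] -/
theorem zeta8_inl_mem_badPlaces_dyadic_iff (hR : R = X ^ 2 + C 6 * X + C 1) (v : HeightOneSpectrum (𝓞 (realField R)))
    (h2 : (2 : 𝓞 (realField R)) ∈ v.asIdeal) (q : (realField R)ˣ) :
    Sum.inl v ∈ badPlaces (q : realField R) (AdjoinRoot.root (realPolyQ R)) ↔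
      Odd {p ∈ badPlaces (q : realField R) (AdjoinRoot.root (realPolyQ R)) |
        ∀ v' : HeightOneSpectrum (𝓞 (realField R)), p = Sum.inl v' → (2 : 𝓞 (realField R)) ∉ v'.asIdeal}.ncard := by
  obtain ⟨s, -, hs⟩ := zeta8_exists_sq_eq_two hR
  exact inl_mem_badPlaces_iff_odd_ncard_of_unique_dyadic q v h2
    (sqrtTwo_dyadic (finrank_realField_quadratic hR) hs v h2).2.2.2

end SqrtTwoFields

section SqrtNegOneSqrtFive

variable {R : Polynomial ℤ} [Fact (Irreducible (cmPolyQ R))] [Fact (Irreducible (realPolyQ R))]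

omit [Fact (Irreducible (cmPolyQ R))] in
/-- `ℚ(i,√5)` (`R = S² + 3S + 1`, `θ = -((1 ∓ √5)/2)²`, `F = ℚ(√5)`): `θ² - θ = -4θ - 1 ∉ v₂`, so the dyadic place of
`F` has residue field `𝔽₄` (`2` inert in `F`). [folklore] -/
theorem sqrtNeg1Sqrt5_sq_sub_self_notMem (hR : R = X ^ 2 + C 3 * X + C 1) {θₒ : 𝓞 (realField R)}
    (hθ : (θₒ : realField R) = AdjoinRoot.root (realPolyQ R)) (v : HeightOneSpectrum (𝓞 (realField R)))
    (h2 : (2 : 𝓞 (realField R)) ∈ v.asIdeal) : θₒ ^ 2 - θₒ ∉ v.asIdeal := by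
  have hrel : θₒ ^ 2 + 3 * θₒ + 1 = 0 := by simpa using ringOfIntegers_root_rel_quadratic hR hθ
  intro h
  have h1 : (1 : 𝓞 (realField R)) = (θₒ ^ 2 + 3 * θₒ + 1) - (θₒ ^ 2 - θₒ) - 2 * (2 * θₒ) := by ring
  rw [hrel, zero_sub] at h1
  have hmem : (1 : 𝓞 (realField R)) ∈ v.asIdeal := by
    rw [h1]
    exact v.asIdeal.sub_mem (v.asIdeal.neg_mem h) (v.asIdeal.mul_mem_right _ h2)
  exact v.isPrime.ne_top ((Ideal.eq_top_iff_one _).2 hmem)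

omit [Fact (Irreducible (cmPolyQ R))] in
/-- **`ℚ(i,√5)`: the dyadic place of `F = ℚ(√5)` is UNIQUE, `= (2)`, `ord 2 = 1`**, in this carrier's terms. [folklore] -/
theorem sqrtNeg1Sqrt5_dyadic (hR : R = X ^ 2 + C 3 * X + C 1) {θₒ : 𝓞 (realField R)}
    (hθ : (θₒ : realField R) = AdjoinRoot.root (realPolyQ R)) (v : HeightOneSpectrum (𝓞 (realField R)))
    (h2 : (2 : 𝓞 (realField R)) ∈ v.asIdeal) :
    v.asIdeal = Ideal.span {(2 : 𝓞 (realField R))} ∧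
      WithZero.log (v.valuation (realField R) (2 : realField R)) = -1 ∧
      ∀ v' : HeightOneSpectrum (𝓞 (realField R)), (2 : 𝓞 (realField R)) ∈ v'.asIdeal → v' = v := by
  have hF := finrank_realField_quadratic hR
  have hx := sqrtNeg1Sqrt5_sq_sub_self_notMem hR hθ
  refine ⟨asIdeal_eq_span_two_of_dyadic_of_sq_sub_self_notMem hF v h2 (hx v h2), ?_,
    fun v' h2' ↦ dyadic_unique_of_sq_sub_self_notMem hF v' v h2' h2 (hx v' h2') (hx v h2)⟩
  rw [show (2 : realField R) = algebraMap (𝓞 (realField R)) (realField R) 2 by rw [map_ofNat],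
    HeightOneSpectrum.valuation_of_algebraMap, intValuation_two_of_dyadic_of_sq_sub_self_notMem hF v h2 (hx v h2),
    WithZero.log_exp]

/-- **THE DYADIC COLUMN for `ℚ(i,√5)`** (`E = F(√-1)` ramified at the inert dyadic place `v₂ = (2)` of `ℚ(√5)`):
`v₂ ∈ T(q) ⟺` the number of non-dyadic places in `T(q)` is odd. [cite: Omeara1963, §71D Thm. 71:18]
[cite: Deligne1982HodgeCycles, §4 (1)] -/
theorem sqrtNeg1Sqrt5_inl_mem_badPlaces_dyadic_iff (hR : R = X ^ 2 + C 3 * X + C 1) {θₒ : 𝓞 (realField R)}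
    (hθ : (θₒ : realField R) = AdjoinRoot.root (realPolyQ R)) (v : HeightOneSpectrum (𝓞 (realField R)))
    (h2 : (2 : 𝓞 (realField R)) ∈ v.asIdeal) (q : (realField R)ˣ) :
    Sum.inl v ∈ badPlaces (q : realField R) (AdjoinRoot.root (realPolyQ R)) ↔
      Odd {p ∈ badPlaces (q : realField R) (AdjoinRoot.root (realPolyQ R)) |
        ∀ v' : HeightOneSpectrum (𝓞 (realField R)), p = Sum.inl v' → (2 : 𝓞 (realField R)) ∉ v'.asIdeal}.ncard :=
  inl_mem_badPlaces_iff_odd_ncard_of_unique_dyadic q v h2 (sqrtNeg1Sqrt5_dyadic hR hθ v h2).2.2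

end SqrtNegOneSqrtFive

end Summit.HodgeConjecture.HodgeConjecture.Ring2.WeilCoverageCM

end
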